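import Literature.Probability.Process.BrownianIncrementSup
import Literature.Probability.Process.ItoTaylorSimple
import HarnessLib

/-!
# Moments of Brownian increments over one cell of a partition, against the past

Elementary inputs of conditional-increment ("Riemann-sum") proofs of martingale properties on the
canonical space `(ℝ≥0 → ℝ, preWienerMeasure)` with the canonical Brownian motion `B = brownian`
and its raw filtration `𝓕 = brownianFiltration`: for a cell `[s, u]` of length `h = u − s`,

* `integral_mul_sqIncr_eq_zero` — **orthogonality of the centred squared increment to the past**,
  `E[ξ ((B_u − B_s)² − h)] = 0` for every bounded `𝓕_s`-measurable `ξ` (companion of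
  `integral_mul_brownian_sub_eq_zero` of `ItoTaylorSimple`; Revuz–Yor Ch. II Prop. (1.2));
* `integral_abs_brownian_sub_moments` — `E|B_u − B_s| ≤ √h`, `E|B_u − B_s|³ ≤ √3 · h^{3/2}`
  (Cauchy–Schwarz with the second and fourth moments);
* `setIntegral_le_sqrt_mul_sqrt` — Cauchy–Schwarz `∫_A f ≤ √(∫ f²) √(P A)`;
* the **bad event** `{incRunSup s h ≥ c}` of large oscillation over the cell: its probability is
  `≤ 128 h²/c⁴` (`measureReal_incRunSup_ge_le'`, from `measure_incRunSup_ge_le`), and on it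
  `E[incRunSup; ·] ≤ 32 h^{3/2}/c²`, `E[(B_{s+h} − B_s)²; ·] ≤ 20 h²/c²` — all `o(h)`, so that summed
  over the `N = (t−s)/h` cells of a partition they vanish as `h → 0` (`tendsto_natCast_mul_rpow_div`).

No named facts.

## References

* D. Revuz, M. Yor, *Continuous Martingales and Brownian Motion* (3rd ed., 1999), Ch. II
  Prop. (1.2), Thm (1.7). [RevuzYor1999]
-/

noncomputable section

open MeasureTheory ProbabilityTheory Filter Set
open scoped NNReal ENNReal Topology

namespace Literature.Probability.Process

open RandomPlanarGeometry (brownianFiltration isProbabilityMeasure_preWienerMeasure' condExp_brownian_sub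
  memLp_two_brownian_sub)

variable {s u : ℝ≥0}

/-! ### Orthogonality of the centred squared increment to the past -/

/-- **`E[ξ ((B_u − B_s)² − (u − s))] = 0`** for `s ≤ u` and every bounded `𝓕_s`-measurable `ξ`
(with `integral_mul_brownian_sub_eq_zero`, `integral_mul_brownian_sub_sq` of `ItoTaylorSimple`:
independence of the increment from `𝓕_s`). [cite: RevuzYor1999, Ch. II Prop. (1.2)(ii)] -/
theorem integral_mul_sqIncr_eq_zero (hsu : s ≤ u) {ξ : (ℝ≥0 → ℝ) → ℝ} {C : ℝ}
    (hξ : StronglyMeasurable[brownianFiltration s] ξ) (hC : ∀ ω, |ξ ω| ≤ C) :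
    ∫ ω, ξ ω * ((brownian u ω - brownian s ω) ^ 2 - ((u : ℝ) - s)) ∂preWienerMeasure = 0 := by
  haveI := isProbabilityMeasure_preWienerMeasure'
  have hm := brownianFiltration.le s (m := (inferInstance : MeasurableSpace (ℝ≥0 → ℝ)))
  have hξm : AEStronglyMeasurable ξ preWienerMeasure := (hξ.mono hm).aestronglyMeasurable
  have hξi : Integrable ξ preWienerMeasure :=
    (integrable_const C).mono' hξm (ae_of_all _ fun ω ↦ by rw [Real.norm_eq_abs]; exact hC ω)
  have hD2 : Integrable (fun ω ↦ (brownian u - brownian s) ω ^ 2) preWienerMeasure := (memLp_two_brownian_sub s u).integrable_sq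
  have hξD2 : Integrable (fun ω ↦ ξ ω * (brownian u - brownian s) ω ^ 2) preWienerMeasure :=
    hD2.bdd_mul hξm (ae_of_all _ fun ω ↦ by rw [Real.norm_eq_abs]; exact hC ω)
  have hsq := integral_mul_brownian_sub_sq hsu hξ
  have e : (fun ω ↦ ξ ω * ((brownian u ω - brownian s ω) ^ 2 - ((u : ℝ) - s))) =
      fun ω ↦ ξ ω * (brownian u - brownian s) ω ^ 2 - ((u : ℝ) - s) * ξ ω := by
    funext ω; simp only [Pi.sub_apply]; ring
  rw [e, integral_sub hξD2 (hξi.const_mul _), integral_const_mul, hsq, sub_self]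

/-! ### Cauchy–Schwarz and moments of the increment -/

/-- **Cauchy–Schwarz**: `∫ f g ≤ √(∫ f²) √(∫ g²)` for nonnegative square-integrable `f, g`.
[folklore] -/
theorem integral_mul_le_sqrt_mul_sqrt {α : Type*} {mα : MeasurableSpace α} {μ : Measure α} {f g : α → ℝ}
    (hf0 : ∀ x, 0 ≤ f x) (hg0 : ∀ x, 0 ≤ g x) (hf : MemLp f 2 μ) (hg : MemLp g 2 μ) :
    ∫ x, f x * g x ∂μ ≤ Real.sqrt (∫ x, f x ^ 2 ∂μ) * Real.sqrt (∫ x, g x ^ 2 ∂μ) := by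
  have h2 : ENNReal.ofReal (2 : ℝ) = 2 := by simp
  have hH := integral_mul_le_Lp_mul_Lq_of_nonneg (μ := μ) Real.HolderConjugate.two_two
    (ae_of_all _ hf0) (ae_of_all _ hg0) (by rw [h2]; exact hf) (by rw [h2]; exact hg)
  simp only [Real.rpow_two] at hH
  rwa [Real.sqrt_eq_rpow, Real.sqrt_eq_rpow]

/-- **`∫_A f ≤ √(∫ f²) · √(μ A)`** for nonnegative square-integrable `f` on a finite measure space.
[folklore] -/
theorem setIntegral_le_sqrt_mul_sqrt {α : Type*} {mα : MeasurableSpace α} {μ : Measure α} [IsFiniteMeasure μ]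
    {f : α → ℝ} (hf0 : ∀ x, 0 ≤ f x) (hf : MemLp f 2 μ) {A : Set α} (hA : MeasurableSet A) :
    ∫ x in A, f x ∂μ ≤ Real.sqrt (∫ x, f x ^ 2 ∂μ) * Real.sqrt (μ.real A) := by
  have hind : ∫ x in A, f x ∂μ = ∫ x, f x * A.indicator (fun _ ↦ (1 : ℝ)) x ∂μ := by
    rw [← integral_indicator hA]
    refine integral_congr_ae (ae_of_all _ fun x ↦ ?_)
    by_cases hx : x ∈ A <;> simp [hx]
  have hg0 : ∀ x, 0 ≤ A.indicator (fun _ ↦ (1 : ℝ)) x := fun x ↦ Set.indicator_nonneg (fun _ _ ↦ zero_le_one) x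
  have hg : MemLp (A.indicator fun _ ↦ (1 : ℝ)) 2 μ := (memLp_const (1 : ℝ)).indicator hA
  have h := integral_mul_le_sqrt_mul_sqrt hf0 hg0 hf hg
  have hsq : ∫ x, A.indicator (fun _ ↦ (1 : ℝ)) x ^ 2 ∂μ = μ.real A := by
    have : (fun x ↦ A.indicator (fun _ ↦ (1 : ℝ)) x ^ 2) = A.indicator fun _ ↦ (1 : ℝ) := by
      funext x; by_cases hx : x ∈ A <;> simp [hx]
    rw [this, integral_indicator hA, setIntegral_const, smul_eq_mul, mul_one]
  rw [hind]; rwa [hsq] at h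

/-- `E|B_u − B_s| ≤ √(u − s)` and **`E|B_u − B_s|³ ≤ √3 (u − s)^{3/2}`** (Cauchy–Schwarz with
`E[(B_u − B_s)²] = u − s`, `E[(B_u − B_s)⁴] = 3(u − s)²`). [cite: RevuzYor1999, Ch. I Thm (2.4) (Gaussian moments)] -/
theorem integral_abs_brownian_sub_moments (hsu : s ≤ u) :
    ∫ ω, |brownian u ω - brownian s ω| ∂preWienerMeasure ≤ Real.sqrt ((u : ℝ) - s) ∧
      ∫ ω, |brownian u ω - brownian s ω| ^ 3 ∂preWienerMeasure ≤ Real.sqrt 3 * (((u : ℝ) - s) * Real.sqrt ((u : ℝ) - s)) := by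
  haveI := isProbabilityMeasure_preWienerMeasure'
  have h2 := RandomPlanarGeometry.integral_brownian_sub_sq hsu
  have h4 := integral_brownian_sub_pow_four s u
  have hm2 : MemLp (fun ω ↦ |brownian u ω - brownian s ω|) 2 preWienerMeasure := (memLp_two_brownian_sub s u).abs
  have hm4 : MemLp (fun ω ↦ (brownian u - brownian s) ω ^ 2) 2 preWienerMeasure := memLp_two_brownian_sub_sq s u
  have habs2 : ∫ ω, |brownian u ω - brownian s ω| ^ 2 ∂preWienerMeasure = (u : ℝ) - s := by
    rw [← h2]; exact integral_congr_ae (ae_of_all _ fun ω ↦ by simp [sq_abs])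
  constructor
  · have h := integral_mul_le_sqrt_mul_sqrt (fun ω ↦ abs_nonneg (brownian u ω - brownian s ω)) (fun _ ↦ zero_le_one)
      hm2 (memLp_const (1 : ℝ))
    simp only [mul_one, one_pow, integral_const, smul_eq_mul, probReal_univ, Real.sqrt_one] at h
    rwa [habs2] at h
  · have h := integral_mul_le_sqrt_mul_sqrt (fun ω ↦ abs_nonneg (brownian u ω - brownian s ω))
      (fun ω ↦ sq_nonneg ((brownian u - brownian s) ω)) hm2 hm4
    have e1 : (fun ω ↦ |brownian u ω - brownian s ω| * (brownian u - brownian s) ω ^ 2) =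
        fun ω ↦ |brownian u ω - brownian s ω| ^ 3 := by
      funext ω; simp only [Pi.sub_apply]; rw [← sq_abs]; ring
    have e2 : ∫ ω, ((brownian u - brownian s) ω ^ 2) ^ 2 ∂preWienerMeasure = 3 * ((u : ℝ) - s) ^ 2 := by
      rw [← h4]; exact integral_congr_ae (ae_of_all _ fun ω ↦ by ring)
    rw [e1, habs2, e2] at h
    have hsu' : (s : ℝ) ≤ u := by exact_mod_cast hsu
    have hus : 0 ≤ (u : ℝ) - s := by linarith
    calc _ ≤ Real.sqrt ((u : ℝ) - s) * Real.sqrt (3 * ((u : ℝ) - s) ^ 2) := h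
      _ = _ := by rw [Real.sqrt_mul (by norm_num : (0 : ℝ) ≤ 3), Real.sqrt_sq hus]; ring

/-! ### The bad event of large oscillation over the cell -/

/-- **`P(incRunSup s h ≥ c) ≤ 128 h²/c⁴`** for `c > 0` and `h ≤ c²/8` (then `(c/2)² − h ≥ c²/8`).
[cite: RevuzYor1999, Ch. II Thm (1.7)] -/
theorem measureReal_incRunSup_ge_le' (s h : ℝ≥0) {c : ℝ} (hc : 0 < c) (hh : (h : ℝ) ≤ c ^ 2 / 8) :
    preWienerMeasure.real {ω | c ≤ incRunSup s h ω} ≤ 128 * (h : ℝ) ^ 2 / c ^ 4 := by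
  haveI := isProbabilityMeasure_preWienerMeasure'
  have hlt : (h : ℝ) < (c / 2) ^ 2 := by nlinarith
  have h1 := measure_incRunSup_ge_le s h hc.le hlt
  have hden : c ^ 2 / 8 ≤ (c / 2) ^ 2 - h := by nlinarith
  have hb : 2 * (h : ℝ) ^ 2 / ((c / 2) ^ 2 - h) ^ 2 ≤ 128 * (h : ℝ) ^ 2 / c ^ 4 := by
    rw [div_le_div_iff₀ (by positivity) (by positivity)]
    have : (c ^ 2 / 8) ^ 2 ≤ ((c / 2) ^ 2 - h) ^ 2 := pow_le_pow_left₀ (by positivity) hden 2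
    nlinarith [sq_nonneg (h : ℝ)]
  calc preWienerMeasure.real {ω | c ≤ incRunSup s h ω}
      = (preWienerMeasure {ω | c ≤ incRunSup s h ω}).toReal := rfl
    _ ≤ (ENNReal.ofReal (2 * (h : ℝ) ^ 2 / ((c / 2) ^ 2 - h) ^ 2)).toReal := ENNReal.toReal_mono ENNReal.ofReal_ne_top h1
    _ = 2 * (h : ℝ) ^ 2 / ((c / 2) ^ 2 - h) ^ 2 := ENNReal.toReal_ofReal (by positivity)
    _ ≤ _ := hb

/-- The bad event is measurable. [folklore] -/
theorem measurableSet_incRunSup_ge (s h : ℝ≥0) (c : ℝ) : MeasurableSet {ω | c ≤ incRunSup s h ω} :=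
  measurableSet_le measurable_const (measurable_incRunSup' s h)

/-- `√128 ≤ 16` and `√3 · √128 ≤ 20`. [folklore] -/
theorem sqrt_128_le : Real.sqrt 128 ≤ 16 ∧ Real.sqrt 3 * Real.sqrt 128 ≤ 20 := by
  constructor
  · rw [Real.sqrt_le_left (by norm_num)]; norm_num
  · rw [← Real.sqrt_mul (by norm_num), Real.sqrt_le_left (by norm_num)]; norm_num

/-- `√(P(bad)) ≤ √128 · h/c²`. [folklore] -/
theorem sqrt_measureReal_incRunSup_ge_le (s h : ℝ≥0) {c : ℝ} (hc : 0 < c) (hh : (h : ℝ) ≤ c ^ 2 / 8) :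
    Real.sqrt (preWienerMeasure.real {ω | c ≤ incRunSup s h ω}) ≤ Real.sqrt 128 * h / c ^ 2 := by
  calc _ ≤ Real.sqrt (128 * (h : ℝ) ^ 2 / c ^ 4) := Real.sqrt_le_sqrt (measureReal_incRunSup_ge_le' s h hc hh)
    _ = Real.sqrt 128 * h / c ^ 2 := by
        rw [show 128 * (h : ℝ) ^ 2 / c ^ 4 = 128 * ((h : ℝ) / c ^ 2) ^ 2 by ring, Real.sqrt_mul (by norm_num),
          Real.sqrt_sq (by positivity)]
        ring

/-- **On the bad event, `E[incRunSup; incRunSup ≥ c] ≤ 32 h^{3/2}/c²`** (`h ≤ c²/8`; Cauchy–Schwarz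
with `E[incRunSup²] ≤ 4h`). [cite: RevuzYor1999, Ch. II Thm (1.7)] -/
theorem setIntegral_incRunSup_bad_le (s h : ℝ≥0) {c : ℝ} (hc : 0 < c) (hh : (h : ℝ) ≤ c ^ 2 / 8) :
    ∫ ω in {ω | c ≤ incRunSup s h ω}, incRunSup s h ω ∂preWienerMeasure ≤ 32 * ((h : ℝ) * Real.sqrt h) / c ^ 2 := by
  haveI := isProbabilityMeasure_preWienerMeasure'
  have hcs := setIntegral_le_sqrt_mul_sqrt (incRunSup_nonneg s h) (memLp_two_incRunSup s h) (measurableSet_incRunSup_ge s h c)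
    (μ := preWienerMeasure)
  have h1 : Real.sqrt (∫ ω, incRunSup s h ω ^ 2 ∂preWienerMeasure) ≤ 2 * Real.sqrt h := by
    have : Real.sqrt (∫ ω, incRunSup s h ω ^ 2 ∂preWienerMeasure) ≤ Real.sqrt (4 * h) := Real.sqrt_le_sqrt (integral_incRunSup_sq_le s h)
    rwa [Real.sqrt_mul (by norm_num), show Real.sqrt 4 = 2 by
      rw [show (4 : ℝ) = 2 ^ 2 by norm_num, Real.sqrt_sq zero_le_two]] at this
  have h2 := sqrt_measureReal_incRunSup_ge_le s h hc hh
  calc _ ≤ 2 * Real.sqrt h * (Real.sqrt 128 * h / c ^ 2) :=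
        hcs.trans (mul_le_mul h1 h2 (Real.sqrt_nonneg _) (by positivity))
    _ ≤ 2 * Real.sqrt h * (16 * h / c ^ 2) := by gcongr; exact sqrt_128_le.1
    _ = _ := by ring

/-- **On the bad event, `E[(B_{s+h} − B_s)²; incRunSup ≥ c] ≤ 20 h²/c²`** (`h ≤ c²/8`; Cauchy–Schwarz
with the fourth moment `3h²`). [cite: RevuzYor1999, Ch. II Thm (1.7)] -/
theorem setIntegral_sq_incr_bad_le (s h : ℝ≥0) {c : ℝ} (hc : 0 < c) (hh : (h : ℝ) ≤ c ^ 2 / 8) :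
    ∫ ω in {ω | c ≤ incRunSup s h ω}, (brownian (s + h) ω - brownian s ω) ^ 2 ∂preWienerMeasure ≤
      20 * (h : ℝ) ^ 2 / c ^ 2 := by
  haveI := isProbabilityMeasure_preWienerMeasure'
  have hcs := setIntegral_le_sqrt_mul_sqrt (fun ω ↦ sq_nonneg ((brownian (s + h) - brownian s) ω))
    (memLp_two_brownian_sub_sq s (s + h)) (measurableSet_incRunSup_ge s h c) (μ := preWienerMeasure)
  have h4 : ∫ ω, ((brownian (s + h) - brownian s) ω ^ 2) ^ 2 ∂preWienerMeasure = 3 * (h : ℝ) ^ 2 := by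
    have := integral_brownian_sub_pow_four s (s + h)
    rw [show ((s + h : ℝ≥0) : ℝ) - s = h by push_cast; ring] at this
    rw [← this]; exact integral_congr_ae (ae_of_all _ fun ω ↦ by ring)
  have h1 : Real.sqrt (∫ ω, ((brownian (s + h) - brownian s) ω ^ 2) ^ 2 ∂preWienerMeasure) = Real.sqrt 3 * h := by
    rw [h4, Real.sqrt_mul (by norm_num), Real.sqrt_sq h.coe_nonneg]
  have h2 := sqrt_measureReal_incRunSup_ge_le s h hc hh
  have e : ∫ ω in {ω | c ≤ incRunSup s h ω}, (brownian (s + h) ω - brownian s ω) ^ 2 ∂preWienerMeasure =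
      ∫ ω in {ω | c ≤ incRunSup s h ω}, (brownian (s + h) - brownian s) ω ^ 2 ∂preWienerMeasure := rfl
  rw [e]
  calc _ ≤ Real.sqrt 3 * h * (Real.sqrt 128 * h / c ^ 2) := by
        rw [← h1]; exact hcs.trans (mul_le_mul_of_nonneg_left h2 (Real.sqrt_nonneg _))
    _ = Real.sqrt 3 * Real.sqrt 128 * (h : ℝ) ^ 2 / c ^ 2 := by ring
    _ ≤ _ := by gcongr; exact sqrt_128_le.2

/-! ### Mesh sums -/

/-- **`N · (c/N)^p → 0`** as `N → ∞` for `p > 1` (the sum over the `N` cells of a partition of an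
`o(h)` cell bound). [folklore] -/
theorem tendsto_natCast_mul_rpow_div {c p : ℝ} (hc : 0 ≤ c) (hp : 1 < p) :
    Tendsto (fun N : ℕ ↦ (N : ℝ) * (c / N) ^ p) atTop (𝓝 0) := by
  have h1 : Tendsto (fun N : ℕ ↦ c ^ p * ((N : ℝ) ^ (p - 1))⁻¹) atTop (𝓝 (c ^ p * 0)) :=
    tendsto_const_nhds.mul ((tendsto_rpow_atTop (by linarith)).comp tendsto_natCast_atTop_atTop).inv_tendsto_atTop
  rw [mul_zero] at h1
  refine h1.congr' ?_
  filter_upwards [eventually_gt_atTop 0] with N hN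
  have hN' : (0 : ℝ) < N := by exact_mod_cast hN
  rw [Real.div_rpow hc hN'.le, Real.rpow_sub hN', Real.rpow_one]
  field_simp

end Literature.Probability.Process

end
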